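import Mathlib.Algebra.Group.Subgroup.Finite
import Mathlib.Data.Fintype.Lattice
import Mathlib.Tactic.Group
import HarnessLib

/-!
# A complement of `⟨c⟩` among the central involutions of a finite group

COR-CM (cell `pub-hodgecm2`), binder seat b04 (gen 34), count-neutral own lane «Galois-CM-type classification».  KERNEL ONLY,
Mathlib only: one theorem; no definition, no named fact, no `sorry`.  Feeder of `CorCM/TwoGroupCentralElementarySplitting` (gen 34):
the central involutions of a finite group `G` form an elementary abelian `2`-group `Ω`, and for `c ∈ Ω ∖ 1` a `c`-avoiding subgroup
`E ≤ Ω` of maximal order is a complement of `⟨c⟩` in `Ω` (if a central involution `s` had `s, cs ∉ E`, then `E ∪ sE` would be a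
larger `c`-avoiding subgroup of central involutions).

* `exists_complement_avoiding` — `c ≠ 1` ⟹ `∃ E ≤ G` of central involutions with `c ∉ E` and every central involution in `E ∪ cE`.
-/

namespace Summit.HodgeConjecture.CorCM.GaloisModels.UniqueInvolution

variable {G : Type*} [Group G]

/-! ## §1 A complement of `⟨c⟩` among the central involutions -/

/-- **A complement of `⟨c⟩` among the central involutions.**  For an element `c ≠ 1` of a finite group there is a subgroup `E` of
central involutions with `c ∉ E` such that every central involution `s` lies in `E ∪ cE` (a `c`-avoiding subgroup of central
involutions of maximal order). [folklore] -/
theorem exists_complement_avoiding [Finite G] (c : G) (hc1 : c ≠ 1) :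
    ∃ E : Subgroup G, c ∉ E ∧ (∀ e ∈ E, e * e = 1 ∧ ∀ g : G, g * e = e * g) ∧
      ∀ s : G, s * s = 1 → (∀ g : G, g * s = s * g) → s ∈ E ∨ c * s ∈ E := by
  classical
  let P : Subgroup G → Prop := fun E => c ∉ E ∧ ∀ e ∈ E, e * e = 1 ∧ ∀ g : G, g * e = e * g
  have hbot : P ⊥ := ⟨fun h => hc1 (Subgroup.mem_bot.1 h), fun e he => by
    rw [Subgroup.mem_bot.1 he]; exact ⟨mul_one 1, fun g => by rw [mul_one, one_mul]⟩⟩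
  haveI : Finite (Subgroup G) := Finite.of_injective (fun H : Subgroup G => (H : Set G)) SetLike.coe_injective
  haveI : Nonempty {E : Subgroup G // P E} := ⟨⟨⊥, hbot⟩⟩
  obtain ⟨⟨E, hcE, hE⟩, hmax⟩ := Finite.exists_max fun E : {E : Subgroup G // P E} => Nat.card E.1
  refine ⟨E, hcE, hE, fun s hss hsc => ?_⟩
  by_contra hnot
  rw [not_or] at hnot
  obtain ⟨hsE, hcsE⟩ := hnot
  -- the larger subgroup `E' = E ∪ sE`
  have hsinv : s⁻¹ = s := inv_eq_of_mul_eq_one_right hss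
  let E' : Subgroup G :=
    { carrier := {g | g ∈ E ∨ s * g ∈ E}
      mul_mem' := by
        rintro a b (ha | ha) (hb | hb)
        · exact Or.inl (E.mul_mem ha hb)
        · right
          rw [show s * (a * b) = a * (s * b) by rw [← mul_assoc, ← hsc a, mul_assoc]]
          exact E.mul_mem ha hb
        · exact Or.inr (by rw [← mul_assoc]; exact E.mul_mem ha hb)
        · left
          have : a * b = (s * a) * (s * b) := by
            rw [show s * a * (s * b) = s * (a * s) * b by group, hsc a, show s * (s * a) * b = (s * s) * (a * b) by group,
              hss, one_mul]
          rw [this]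
          exact E.mul_mem ha hb
      one_mem' := Or.inl E.one_mem
      inv_mem' := by
        rintro a (ha | ha)
        · exact Or.inl (E.inv_mem ha)
        · right
          have : s * a⁻¹ = (s * a)⁻¹ := by rw [mul_inv_rev, hsinv, ← hsc a⁻¹]
          rw [this]
          exact E.inv_mem ha }
  have hmemE' : ∀ g : G, g ∈ E' ↔ g ∈ E ∨ s * g ∈ E := fun g => Iff.rfl
  have hPE' : P E' := by
    refine ⟨fun h => ?_, fun e he => ?_⟩
    · rcases (hmemE' c).1 h with h | h
      · exact hcE h
      · rw [← hsc c] at h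
        exact hcsE h
    · rcases (hmemE' e).1 he with h | h
      · exact hE e h
      · obtain ⟨h1, h2⟩ := hE _ h
        have hes : e = s * (s * e) := by rw [← mul_assoc, hss, one_mul]
        refine ⟨?_, fun g => ?_⟩
        · rw [hes, show s * (s * e) * (s * (s * e)) = (s * s) * ((s * e) * (s * e)) by
            rw [show s * (s * e) * (s * (s * e)) = s * ((s * e) * s) * (s * e) by group, hsc (s * e)]; group, hss, h1,
            one_mul]
        · rw [hes, ← mul_assoc g s, hsc g, mul_assoc s g, h2 g, ← mul_assoc, ← mul_assoc]
  have hle : E ≤ E' := fun g hg => (hmemE' g).2 (Or.inl hg)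
  have hsE' : s ∈ E' := (hmemE' s).2 (Or.inr (by rw [hss]; exact E.one_mem))
  have hlt : Nat.card E < Nat.card E' := by
    refine lt_of_le_of_ne (Subgroup.card_le_of_le hle) fun h => hsE ?_
    rw [Subgroup.eq_of_le_of_card_ge hle h.ge]
    exact hsE'
  exact absurd (hmax ⟨E', hPE'⟩) (not_le.2 hlt)

end Summit.HodgeConjecture.CorCM.GaloisModels.UniqueInvolution
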